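import Mathlib
import Literature.Analysis.FluidPDE.AxisymNoSwirlScaleInvariantBounds
import HarnessLib.Audit
import HarnessLib

/-!
# L3TimeExponentPincer — ring persistence, kernel steps (i) and (iii) (ROUND-11, seat nsreg-p2)

Two uniform-in-time vorticity bounds for single-signed, finite-impulse, axisymmetric swirl-free
Tao-class solutions (`ν = 1`), from the tree's maximum principle for `η = ω_θ/r`
(`AxisymNoSwirlQuotMaxPrinciple`), Gallay–Šverák's Lemma 5.1 (tree theorem
`IsTaoSolutionOn.lintegral_abs_angVortQuot_le_of_datum`) and the NAMED FACT
`GallaySverak2015.ImpulseConservation` (Lemma 6.4):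

* `enstrophy_le_of_impulse` — **a ring cannot concentrate its enstrophy**:
  `‖ω(t)‖₂² = ∫ r²η(t)² ≤ M · ∫ r²η₀` for every `t ∈ [0,T]`, `M = sup η₀` (step (i) of the
  ROUND-11 Persistence Lemma: with the energy identity it keeps the energy `≥ E₀/2` up to
  `t_* = E₀/(2M·∫r²η₀) ≍ ℓ²`, i.e. for `≍ Re` turnovers);
* `vorticity_l1_le_of_impulse` — `‖ω(t)‖₁ ≤ √(∫η₀ · ∫r²η₀)` for every `t ∈ [0,T]` (step (iii);
  this is the intermediate `hAω` of the tree's `speedCap_of_facts`, exported).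

Both are dimensionally exact on rings (`M·P ≍ U²ℓ = ‖ω₀‖₂²`, `√(mP) ≍ Uℓ² = ‖ω₀‖₁`).
-/

namespace Summit.NavierStokesRegularity.NavierStokesRegularity.Theorems.L3TimeExponentPincerRingEnstrophy

open MeasureTheory Set Filter Literature.Analysis.FluidPDE
open scoped ENNReal NNReal

/-- `ℝ³`. -/
abbrev E3 := EuclideanSpace ℝ (Fin 3)

/-- **Step (i): uniform enstrophy bound.** For a Tao-class solution (`ν = 1`) from an axisymmetric
swirl-free datum with `0 ≤ η₀ ≤ M`, `η₀ ∈ L¹`, `r²η₀ ∈ L¹`: `∫‖ω(t)‖² ≤ M·∫r²η₀` on `[0,T]`. -/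
theorem enstrophy_le_of_impulse (hI : GallaySverak2015.ImpulseConservation) {T : ℝ} {u₀ : E3 → E3}
    {u : ℝ → E3 → E3} {p : ℝ → E3 → ℝ} {M : ℝ} (hT : 0 < T) (h : IsTaoSolutionOn T 1 u₀ u p)
    (h0 : IsAxisymmetric u₀) (h0' : HasNoSwirl u₀) (hη0 : ∀ x, 0 ≤ angVortQuot u₀ x)
    (hηM : ∀ x, angVortQuot u₀ x ≤ M) (hL1 : Integrable (angVortQuot u₀))
    (hImp : Integrable (fun x => cylRadius x ^ 2 * angVortQuot u₀ x)) {t : ℝ} (ht : t ∈ Icc 0 T) :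
    Integrable (fun x => ‖curl (u t) x‖ ^ 2) ∧
      ∫ x, ‖curl (u t) x‖ ^ 2 ≤ M * ∫ x, cylRadius x ^ 2 * angVortQuot u₀ x := by
  have hax : IsAxisymmetric (u t) := h.isAxisymmetric one_pos hT h0 t ht
  have hsw : HasNoSwirl (u t) := h.hasNoSwirl one_pos hT h0 h0' t ht
  have hu3 : ContDiff ℝ 3 (u t) := (h.classical.contDiff_velocity ht).of_le (by norm_cast)
  have hu1 : ContDiff ℝ 1 (u t) := hu3.of_le (by norm_cast)
  have habs0 : ∀ y, |angVortQuot u₀ y| ≤ M := fun y => by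
    rw [abs_of_nonneg (hη0 y)]; exact hηM y
  have hηt0 : ∀ y, 0 ≤ angVortQuot (u t) y := fun y =>
    h.angVortQuot_nonneg_of_datum hT one_pos h0 h0' hη0 ht y
  have hηtM : ∀ y, |angVortQuot (u t) y| ≤ M := fun y =>
    h.abs_angVortQuot_le_of_datum hT one_pos h0 h0' habs0 ht y
  have hωeq : ∀ y, ‖curl (u t) y‖ = cylRadius y * |angVortQuot (u t) y| :=
    norm_curl_eq_cylRadius_mul_abs_angVortQuot hax hsw hu3
  obtain ⟨hIt, hIeq⟩ := hI hT h h0 h0' hη0 hL1 hImp t ht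
  -- pointwise: `‖ω‖² = r²η² ≤ M·r²η`
  have hpt : ∀ y, ‖curl (u t) y‖ ^ 2 ≤ M * (cylRadius y ^ 2 * angVortQuot (u t) y) := fun y => by
    have hη := hηt0 y
    have hηM' : angVortQuot (u t) y ≤ M := (le_abs_self _).trans (hηtM y)
    have h1 : angVortQuot (u t) y ^ 2 ≤ M * angVortQuot (u t) y := by nlinarith
    rw [hωeq y, mul_pow, sq_abs]
    calc cylRadius y ^ 2 * angVortQuot (u t) y ^ 2
        ≤ cylRadius y ^ 2 * (M * angVortQuot (u t) y) := mul_le_mul_of_nonneg_left h1 (sq_nonneg _)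
      _ = M * (cylRadius y ^ 2 * angVortQuot (u t) y) := by ring
  have hωc : Continuous (curl (u t)) := continuous_curl hu1
  have hmeas : AEStronglyMeasurable (fun x => ‖curl (u t) x‖ ^ 2) volume :=
    (hωc.norm.pow 2).aestronglyMeasurable
  have hint : Integrable (fun x => ‖curl (u t) x‖ ^ 2) :=
    Integrable.mono' (hIt.const_mul M) hmeas (Eventually.of_forall fun y => by
      rw [Real.norm_of_nonneg (sq_nonneg _)]; exact hpt y)
  refine ⟨hint, ?_⟩
  calc ∫ x, ‖curl (u t) x‖ ^ 2 ≤ ∫ x, M * (cylRadius x ^ 2 * angVortQuot (u t) x) :=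
        integral_mono hint (hIt.const_mul M) hpt
    _ = M * ∫ x, cylRadius x ^ 2 * angVortQuot u₀ x := by rw [integral_const_mul, hIeq]

/-- **Step (iii): uniform `L¹` vorticity bound.** Same hypotheses: `∫‖ω(t)‖ ≤ √(∫η₀ · ∫r²η₀)`
on `[0,T]` (Lemma 5.1 + Lemma 6.4 + Cauchy–Schwarz `integral_cylRadius_mul_le_sqrt`). -/
theorem vorticity_l1_le_of_impulse (hI : GallaySverak2015.ImpulseConservation) {T : ℝ} {u₀ : E3 → E3}
    {u : ℝ → E3 → E3} {p : ℝ → E3 → ℝ} {M : ℝ} (hT : 0 < T) (h : IsTaoSolutionOn T 1 u₀ u p)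
    (h0 : IsAxisymmetric u₀) (h0' : HasNoSwirl u₀) (hη0 : ∀ x, 0 ≤ angVortQuot u₀ x)
    (hηM : ∀ x, angVortQuot u₀ x ≤ M) (hL1 : Integrable (angVortQuot u₀))
    (hImp : Integrable (fun x => cylRadius x ^ 2 * angVortQuot u₀ x)) {t : ℝ} (ht : t ∈ Icc 0 T) :
    Integrable (curl (u t)) ∧
      ∫ y, ‖curl (u t) y‖ ≤ Real.sqrt ((∫ y, angVortQuot u₀ y) *
        ∫ y, cylRadius y ^ 2 * angVortQuot u₀ y) := by
  have h0T : (0 : ℝ) ∈ Icc 0 T := ⟨le_rfl, hT.le⟩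
  have hax : IsAxisymmetric (u t) := h.isAxisymmetric one_pos hT h0 t ht
  have hsw : HasNoSwirl (u t) := h.hasNoSwirl one_pos hT h0 h0' t ht
  have hu3 : ContDiff ℝ 3 (u t) := (h.classical.contDiff_velocity ht).of_le (by norm_cast)
  have hu1 : ContDiff ℝ 1 (u t) := hu3.of_le (by norm_cast)
  have hηc : Continuous (angVortQuot (u t)) :=
    (contDiff_angVortQuot (n := 0) (by exact_mod_cast hu3)).continuous
  have habs0 : ∀ y, |angVortQuot u₀ y| ≤ M := fun y => by
    rw [abs_of_nonneg (hη0 y)]; exact hηM y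
  have hηt0 : ∀ y, 0 ≤ angVortQuot (u t) y := fun y =>
    h.angVortQuot_nonneg_of_datum hT one_pos h0 h0' hη0 ht y
  have hωeq : ∀ y, ‖curl (u t) y‖ = cylRadius y * |angVortQuot (u t) y| :=
    norm_curl_eq_cylRadius_mul_abs_angVortQuot hax hsw hu3
  -- `η(t) ∈ L¹` with `∫|η(t)| ≤ ∫η₀` (Lemma 5.1, tree)
  have hlin : ∫⁻ y, ‖angVortQuot (u t) y‖ₑ ≤ ∫⁻ y, ‖angVortQuot u₀ y‖ₑ := by
    have := h.lintegral_abs_angVortQuot_le_of_datum hT one_pos h0 h0' h0T ht ht.1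
    rwa [h.initial] at this
  have hηint : Integrable (angVortQuot (u t)) :=
    ⟨hηc.aestronglyMeasurable, lt_of_le_of_lt hlin hL1.hasFiniteIntegral⟩
  have hA : ∫ y, |angVortQuot (u t) y| ≤ ∫ y, angVortQuot u₀ y := by
    have e1 : ∫ y, |angVortQuot (u t) y| = (∫⁻ y, ‖angVortQuot (u t) y‖ₑ).toReal := by
      rw [← integral_norm_eq_lintegral_enorm hηc.aestronglyMeasurable]
      simp only [Real.norm_eq_abs]
    have e2 : ∫ y, angVortQuot u₀ y = (∫⁻ y, ‖angVortQuot u₀ y‖ₑ).toReal := by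
      rw [← integral_norm_eq_lintegral_enorm hL1.aestronglyMeasurable]
      exact integral_congr_ae (Eventually.of_forall fun y => by
        simp only [Real.norm_eq_abs, abs_of_nonneg (hη0 y)])
    rw [e1, e2]
    exact ENNReal.toReal_mono hL1.hasFiniteIntegral.ne hlin
  -- the impulse at time `t` (Lemma 6.4)
  obtain ⟨hIt, hIeq⟩ := hI hT h h0 h0' hη0 hL1 hImp t ht
  have hB : ∫ y, cylRadius y ^ 2 * |angVortQuot (u t) y| =
      ∫ y, cylRadius y ^ 2 * angVortQuot u₀ y := by
    rw [← hIeq]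
    exact integral_congr_ae (Eventually.of_forall fun y => by
      simp only [abs_of_nonneg (hηt0 y)])
  have hωc : Continuous (curl (u t)) := continuous_curl hu1
  have hωint : Integrable (curl (u t)) := by
    refine Integrable.mono' ((hηint.abs.add hIt).div_const 2) hωc.aestronglyMeasurable
      (Eventually.of_forall fun y => ?_)
    show ‖curl (u t) y‖ ≤ (|angVortQuot (u t) y| + cylRadius y ^ 2 * angVortQuot (u t) y) / 2
    rw [hωeq y]
    have e : cylRadius y ^ 2 * angVortQuot (u t) y = cylRadius y ^ 2 * |angVortQuot (u t) y| := by
      rw [abs_of_nonneg (hηt0 y)]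
    rw [e]
    nlinarith [mul_nonneg (sq_nonneg (cylRadius y - 1)) (abs_nonneg (angVortQuot (u t) y))]
  refine ⟨hωint, ?_⟩
  calc ∫ y, ‖curl (u t) y‖ = ∫ y, cylRadius y * |angVortQuot (u t) y| := integral_congr_ae
        (Eventually.of_forall fun y => hωeq y)
    _ ≤ Real.sqrt (∫ y, |angVortQuot (u t) y|) *
          Real.sqrt (∫ y, cylRadius y ^ 2 * |angVortQuot (u t) y|) :=
        integral_cylRadius_mul_le_sqrt hηint hIt
    _ ≤ Real.sqrt (∫ y, angVortQuot u₀ y) *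
          Real.sqrt (∫ y, cylRadius y ^ 2 * angVortQuot u₀ y) := by
        rw [hB]
        exact mul_le_mul_of_nonneg_right (Real.sqrt_le_sqrt hA) (Real.sqrt_nonneg _)
    _ = Real.sqrt ((∫ y, angVortQuot u₀ y) * ∫ y, cylRadius y ^ 2 * angVortQuot u₀ y) := by
        rw [Real.sqrt_mul (integral_nonneg fun y => hη0 y)]

/--
info: 'Summit.NavierStokesRegularity.NavierStokesRegularity.Theorems.L3TimeExponentPincerRingEnstrophy.enstrophy_le_of_impulse' depends on axioms: [propext,
 Classical.choice,
 Quot.sound]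
-/
#guard_msgs in
#print axioms enstrophy_le_of_impulse

end Summit.NavierStokesRegularity.NavierStokesRegularity.Theorems.L3TimeExponentPincerRingEnstrophy
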